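import Summits.Ventures.CertifiedManyBodySolver.Observables.StiffnessApexTransport
import HarnessLib

/-!
# Ventures/CertifiedManyBodySolver — Observables/StiffnessApexTransportCurtain.lean

HONEST FRAMING: one-sided certified CEILINGS on the uniform flux stiffness (`t–t′` f-sum class) at half filling, TRANSPORTED into a
`(t′, U)` box from a «curtain» of sources; a ceiling never speaks to the presence of order; not a `T_c` estimate, not a superconductivity
verdict; every leaf is CONDITIONAL on the row families it names. Zero compute, no definition, no claim node, no `sorry`.

Cell `pub/hubbard-downfold` (D-0150 L-DF2 «box ↦ one word»), seat `hubbard-downfold-unc-2` (`prover-hubbard-downfold-unc-2-g15-0`); sequel of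
`Observables/StiffnessApexTransport.lean` (the apex BOX instrument from ONE station) written to REMOVE or REPRICE its one weakness, the
OVERHANG: from one station `U_A` the box `[p, q] × [U_A, U_max]` (`q ≤ 0`) is covered only if the station's source segment extends to
`p(2 − U_A/U_max)` — for «La214-E» to `t′ = −357/740 ≈ −0.48` — and the companion's box lemma asks every source for its OWN f-sum word, whose
kinematic scale `k(s) = −¼e_free(1,2s,0;1)` grows with `|s|` (0.4392 at `−3/10`, 0.5037 at `−357/740`).

THE POINT. The apex row transports EXACTLY the TARGET's objective: `e_{Φ(1,2t′_P,0)}(ω_A) ≤ e_{Φ(1,2t′_P,0)}(ω_P)` (companion §2,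
`…_of_apexSource_orbitLowerRow`), and at half filling a source row at ANY hopping slot `σ ≤ t′_P` (more precisely `2σ − 2t′_P = k·t′_A`, `k ≥ 0`)
implies it (`IsTorusLimitOf.meanEnergy_oneBody_anti_hopping_of_groundState_halfFilling`: the diagonal-hopping energy has the sign of `−t′`).
Every target of the box has `t′_P ≥ p`, so a source OUTSIDE the box (on the overhang) never needs more than the CORNER objective `−X₀(p)`
(slot `σ = p`), whose kinematic scale is `k(p)` at every overhang source; and a source ON THE LEFT EDGE `t′ = p` needs only its own word.
Hence three zero-solve «curtain» editions (§3), all instances of ONE engine (§1) and ONE master theorem (§2):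

* §1 ENGINE `ObsStiffnessSeqCeilingAt_halfFilling_of_apexSource_orbitLower_slot` — an unconditional orbit-lower statement for `−X₀(σ)` on the
  source class at `A = (t′_A, U_A)` on the apex segment of the target `P` (`U_P·t′_A = (2U_P − U_A)·t′_P`, `U_A ≤ U_P`), with the slot condition
  `2σ − 2t′_P = k·t′_A`, `k ≥ 0`, words `P`;
* §2 MASTER «curtain» theorem `ObsStiffnessSeqCeilingAt_halfFilling_on_box_of_curtain_orbitLower`: BOTTOM inner segment `[p, q] × {U_A}` (own
  words) + LEFT EDGE `{p} × [U_A, U_L]` (own words) + OVERHANG `[p(2 − U_L/U_max), p] × {U_L}` with the CORNER objective `−X₀(p)` ⇒ the whole box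
  `[p, q] × [U_A, U_max]`, for any `U_L ≥ U_A` (`U_L ≥ U_max` empties the overhang);
* §3 EDITIONS: (E1) `U_L = U_A` — ONE station, inner own-word bundle + overhang bundle with the FIXED corner objective
  (`…_on_box_of_apexStation_inner_and_cornerObjectiveOverhang`); (E2) `U_L = U_max` — the «L»: bottom inner bundle + the whole left edge, NO
  overhang, every source inside the box (`…_on_box_of_bottomEdge_and_leftEdge`); (E3) = §2 itself (partial left edge, short overhang at `U_L`);
* CHORD forms (what two-corner shared-dual bundles deliver) and the «La214-E» `[−3/10, −1/5] × [29/5, 74/5]` instances of (E1)/(E2)/(E3) are in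
  the companion `Observables/StiffnessApexTransportCurtainLaBoxE.lean`.

WHAT CHANGES FOR THE PLANNER (numbers [float], planning arithmetic only): under (E1) the a-priori (kinematic) scale of EVERY overhang source
word is `k(p)` (La214-E: 0.4392, i.e. the bar 0.4364687 asks 0.6 % below kinematic everywhere on the overhang) instead of `k(s)` (13.3 % at
`−357/740` under the own-word edition of the companion / `…LaBoxE`); under (E2) there is no overhang and no source outside the box, at the
price of `U`-segment bundles on the left edge (high-`U` windows); (E3) interpolates. Which is cheaper is the solver's call, not this file's.

NOT said: nothing flows toward smaller `U`; only `n = 1` here (the doped, priced edition of the slot engine is the companion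
`StiffnessApexTransportDoped` §2 with `B`-levers — a sequel can reprice it the same way); `λ ≠ 0` words are not of this form; no `T > 0`; no number
of record.

References: T. Koma, H. Tasaki, J. Stat. Phys. 76 (1994) 745, §1 [KomaTasaki1994]; D. J. Scalapino, S. R. White, S.-C. Zhang, PRB 47 (1993)
7995, §II [ScalapinoWhiteZhang1993]; T. Hazra, N. Verma, M. Randeria, PRX 9 (2019) 031049, eq. (4) [HazraVermaRanderia2019].
-/

noncomputable section

namespace Summit.Ventures.CertifiedManyBodySolver.Observables

open Literature.MathematicalPhysics.QuantumLattice
open Literature.MathematicalPhysics.QuantumLattice.ThermodynamicLimit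
open Literature.MathematicalPhysics.QuantumFieldTheory
open Literature.Probability.LatticeModels
open Matrix Finset Filter Topology HubbardWave0
open scoped Matrix BigOperators ComplexOrder

/-! ## §1 ENGINE: a source row at ANY admissible hopping slot on the apex segment words the target (half filling) -/

section Engine

variable {t'A UA t'P UP : ℝ}

/-- **Slot engine (half filling).** Source `A = (t′_A, U_A)` on the apex segment of the target `P = (t′_P, U_P)`:
`U_P·t′_A = (2U_P − U_A)·t′_P`, `0 ≤ U_A ≤ U_P`, `0 < U_P`. If every torus limit `ω` of unit `(rectN 1 L, S^z = 0)`-sector ground states of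
`hubbardTorusTT' L 1 t′_A U_A` satisfies the UNCONDITIONAL orbit-lower statement `v ≤ |D₄|⁻¹ Σ_γ Re ω_{γΛ₇}(Γ_γ(−X₀(σ, Uo)))` for the `λ = 0` word
at a hopping SLOT `σ` (any `U`-slot `Uo`) with `2σ − 2t′_P = k·t′_A`, `k ≥ 0` (i.e. `σ` on the far side of `t′_P` in the direction of `t′_A`), then
`ObsStiffnessSeqCeilingAt t′_P U_P 1 c` for every rational `c ≥ −v`. Proof: on the source class `¼e_{Φ(1,2σ,0)} = ` the orbit mean, and
`e_{Φ(1,2σ,0)} ≤ e_{Φ(1,2t′_P,0)}` (`t′·K₂ ≤ 0` at `n = 1`); then the doubled-hopping apex row from `A` to `P` (or `A = P` when `U_A = U_P`).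
Slots: `σ = t′_A` is the companion's own-word leaf, `σ = t′_P` its target-objective leaf; on a box every `σ ≤ t′_P` with the sign of `t′_A` works.
[cite: KomaTasaki1994, §1] [cite: ScalapinoWhiteZhang1993, §II] -/
theorem ObsStiffnessSeqCeilingAt_halfFilling_of_apexSource_orbitLower_slot (σ Uo v : ℝ) (hUA : 0 ≤ UA) (hU : UA ≤ UP)
    (hUP : 0 < UP) (hapex : UP * t'A = (2 * UP - UA) * t'P)
    (h : ∀ (ω : InfVolFermionState 2) (Ls : ℕ → ℕ) (ψ : ∀ L, Fock (Orb (FermionTorus 2 L))),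
      Tendsto Ls atTop atTop →
      (∀ j, IsGroundStateInSector (hubbardTorusTT' (Ls j) 1 t'A UA) (rectN 1 (Ls j)) 0 (ψ (Ls j))) →
      (∀ j, star (ψ (Ls j)) ⬝ᵥ ψ (Ls j) = 1) → ω.IsTorusLimitOf ψ Ls →
      v ≤ ((Finset.univ : Finset (DihedralGroup 4)).card : ℝ)⁻¹ * ∑ g ∈ (Finset.univ : Finset (DihedralGroup 4)),
        (ω.expect (d4ShiftSet g 0 (box 2 7)) (fermionEmbed (PolySite.d4Emb g 0 (box 2 7)) (-oddMomentObsTT σ Uo 0))).re)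
    {k : ℝ} (hk : 0 ≤ k) (hslot : 2 * σ - 2 * t'P = k * t'A) (c : ℚ) (hc : -v ≤ ((c : ℚ) : ℝ)) :
    ObsStiffnessSeqCeilingAt t'P UP 1 c := by
  intro ρs θ₀ _ hθ₀ Ls hLs hst
  refine fluxStiffness_le_of_torusLimitTT'_oddMoment_orbit_certificate_seq t'P (U := UP) (δ := 1 - 1) (q := ((c : ℚ) : ℝ)) 0
    Finset.univ Finset.univ_nonempty (by norm_num) (by norm_num) hθ₀ hLs hst ?_
  intro ω Ms ψ hMs hψ h1 hω
  have hψ' : ∀ j, IsGroundStateInSector (hubbardTorusTT' (Ms j) 1 t'P UP) (rectN 1 (Ms j)) 0 (ψ (Ms j)) := fun j => by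
    simpa only [sub_sub_cancel] using hψ j
  rw [orbitMean_rotOddMomentLimitFunctionalTT_lam_zero_eq_meanEnergy_twice_tPrime hω.isTranslationInvariant]
  rcases hU.eq_or_lt with heq | hlt
  · -- the source class IS the target class (`U_A = U_P` forces `t′_A = t′_P`)
    subst heq
    have htA : t'A = t'P := by
      have h2 : (2 * UA - UA) * t'P = UA * t'P := by ring
      exact mul_left_cancel₀ hUP.ne' (hapex.trans h2)
    subst htA
    have hv := h ω Ms ψ hMs hψ' h1 hω
    rw [orbitMean_re_expect_neg_oddMomentTT_lam_zero hω.isTranslationInvariant] at hv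
    have hmono := InfVolFermionState.IsTorusLimitOf.meanEnergy_oneBody_anti_hopping_of_groundState_halfFilling 1 t'A hUA
      hω hMs hψ' h1 hk hslot
    linarith
  · -- genuine transport from an inhabitant of the source class
    obtain ⟨ψA, φ, ωA, hφ, hψA, hψA1, hωA, -, -, -⟩ :=
      exists_isTorusLimitOf_sectorGroundState_TT' 1 t'A UA zero_le_one one_le_two (Ls := id) tendsto_id
    have hLφ : Tendsto (id ∘ φ : ℕ → ℕ) atTop atTop := tendsto_id.comp hφ.tendsto_atTop
    have hapx := InfVolFermionState.IsTorusLimitOf.meanEnergy_twice_tPrime_le_of_groundStates_apex 1 t'A t'P hUA hlt hapex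
      zero_le_one one_lt_two hωA hLφ (fun j => hψA _) (fun j => hψA1 _) hω hMs hψ' h1
    have hmono := InfVolFermionState.IsTorusLimitOf.meanEnergy_oneBody_anti_hopping_of_groundState_halfFilling 1 t'A hUA
      hωA hLφ (fun j => hψA _) (fun j => hψA1 _) hk hslot
    have hv := h ωA (id ∘ φ) ψA hLφ (fun j => hψA _) (fun j => hψA1 _) hωA
    rw [orbitMean_re_expect_neg_oddMomentTT_lam_zero hωA.isTranslationInvariant] at hv
    linarith

end Engine

/-! ## §2 MASTER THEOREM: the «curtain» bottom inner segment + left edge to `U_L` + corner-objective overhang at `U_L` -/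

section Curtain

variable {UA UL Umax p q : ℝ}

/-- **Where the apex segment of a box target crosses the left edge.** Target `(t′_P, U_P)` with `p ≤ t′_P < 0`, `0 < U_P`: the apex
segment from `(2t′_P, 0)` to `(t′_P, U_P)` meets the line `t′ = p` at the height `U' = U_P(2 − p/t′_P) ≤ U_P`, and the pair
`A = (p, U')`, `P` satisfies the apex relation `U_P·p = (2U_P − U')·t′_P`. [folklore] -/
theorem leftEdge_apexSource {p t'P UP : ℝ} (htp : p ≤ t'P) (ht0 : t'P < 0) (hUP : 0 < UP) :
    UP * (2 - p / t'P) ≤ UP ∧ UP * p = (2 * UP - UP * (2 - p / t'P)) * t'P := by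
  have ht : t'P ≠ 0 := ht0.ne
  refine ⟨?_, ?_⟩
  · have h1 : 1 ≤ p / t'P := by
      rw [le_div_iff_of_neg ht0, one_mul]
      exact htp
    nlinarith
  · field_simp
    ring

/-- **The source height on the left edge exceeds the station iff the station's source parameter overhangs.** For a target `(t′_P, U_P)`
with `t′_P < 0`, `0 < U_P` and a station `U_S`: `t′_P(2U_P − U_S)/U_P < p ↔ U_S < U_P(2 − p/t′_P)`. [folklore] -/
theorem apexSource_lt_iff_station_lt_leftEdge {p t'P UP US : ℝ} (ht0 : t'P < 0) (hUP : 0 < UP) :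
    t'P * (2 * UP - US) / UP < p ↔ US < UP * (2 - p / t'P) := by
  have ht : t'P ≠ 0 := ht0.ne
  have e1 : t'P * (2 * UP - US) / UP = t'P * (2 - US / UP) := by field_simp
  have e2 : UP * (2 - p / t'P) = 2 * UP - UP * p / t'P := by ring
  rw [e1, e2]
  constructor
  · intro h
    -- divide `t′_P (2 − U_S/U_P) < p` by `t′_P < 0`
    have h' : p / t'P < 2 - US / UP := by rwa [div_lt_iff_of_neg ht0, mul_comm]
    have h'' : UP * (p / t'P) < UP * (2 - US / UP) := mul_lt_mul_of_pos_left h' hUP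
    have e3 : UP * (2 - US / UP) = 2 * UP - US := by field_simp
    have e4 : UP * (p / t'P) = UP * p / t'P := by ring
    linarith [h'', e3, e4]
  · intro h
    have e3 : UP * (2 - US / UP) = 2 * UP - US := by field_simp
    have e4 : UP * (p / t'P) = UP * p / t'P := by ring
    have h'' : UP * (p / t'P) < UP * (2 - US / UP) := by linarith
    have h' : p / t'P < 2 - US / UP := lt_of_mul_lt_mul_left h'' hUP.le
    rwa [div_lt_iff_of_neg ht0, mul_comm] at h'

/-- **THE CURTAIN THEOREM (half filling).** Box `[p, q] × [U_A, U_max]` with `q ≤ 0 < U_A ≤ U_L` (for `U_L ≥ U_max` the overhang segment below is empty or the corner). Three unconditional orbit-lower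
families for the `λ = 0` f-sum word on torus-limit ground-state classes at density `1`:
(BOTTOM) `valB s ≤ orbit mean of −X₀(s)` on the class at `(s, U_A)` for `s ∈ [p, q]` — each bottom source's OWN word;
(LEFT) `valL U' ≤ orbit mean of −X₀(p)` on the class at `(p, U')` for `U' ∈ [U_A, U_L]` — each left-edge source's OWN word;
(OVERHANG at `U_L`) `valO s ≤ orbit mean of −X₀(p)` on the class at `(s, U_L)` for `s ∈ [p(2 − U_L/U_max), p]` — the CORNER objective `−X₀(p)`,
NOT the source's own `−X₀(s)`; with `−valB, −valL, −valO ≤ c` on their domains. Then `ObsStiffnessSeqCeilingAt t′ U 1 c` at EVERY point of the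
box. Proof: the apex segment of a target `(t′, U)` passes the height `U_A` at `s_A = t′(2U − U_A)/U`; if `s_A ≥ p` the bottom family words it
(companion station leaf); otherwise it crosses the left edge at the height `U' = U(2 − p/t′) ∈ (U_A, U]` — if `U' ≤ U_L` the left family words
it (slot `p ≤ t′`), else it passes the height `U_L` at `s_L = t′(2U − U_L)/U ∈ [p(2 − U_L/U_max), p)` and the overhang family words it (slot `p`).
Editions: `U_L = U_A` (one station + corner-objective overhang), `U_L = U_max` (the «L», no overhang) — §3.
[cite: KomaTasaki1994, §1] [cite: ScalapinoWhiteZhang1993, §II] -/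
theorem ObsStiffnessSeqCeilingAt_halfFilling_on_box_of_curtain_orbitLower (hUA : 0 < UA) (hAL : UA ≤ UL) (hq : q ≤ 0) (valB valL valO : ℝ → ℝ) (c : ℚ)
    (hB : ∀ s ∈ Set.Icc p q,
      ∀ (ω : InfVolFermionState 2) (Ls : ℕ → ℕ) (ψ : ∀ L, Fock (Orb (FermionTorus 2 L))),
      Tendsto Ls atTop atTop →
      (∀ j, IsGroundStateInSector (hubbardTorusTT' (Ls j) 1 s UA) (rectN 1 (Ls j)) 0 (ψ (Ls j))) →
      (∀ j, star (ψ (Ls j)) ⬝ᵥ ψ (Ls j) = 1) → ω.IsTorusLimitOf ψ Ls →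
      valB s ≤ ((Finset.univ : Finset (DihedralGroup 4)).card : ℝ)⁻¹ * ∑ g ∈ (Finset.univ : Finset (DihedralGroup 4)),
        (ω.expect (d4ShiftSet g 0 (box 2 7)) (fermionEmbed (PolySite.d4Emb g 0 (box 2 7)) (-oddMomentObsTT s UA 0))).re)
    (hcB : ∀ s ∈ Set.Icc p q, -valB s ≤ ((c : ℚ) : ℝ))
    (hL : ∀ U' ∈ Set.Icc UA UL,
      ∀ (ω : InfVolFermionState 2) (Ls : ℕ → ℕ) (ψ : ∀ L, Fock (Orb (FermionTorus 2 L))),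
      Tendsto Ls atTop atTop →
      (∀ j, IsGroundStateInSector (hubbardTorusTT' (Ls j) 1 p U') (rectN 1 (Ls j)) 0 (ψ (Ls j))) →
      (∀ j, star (ψ (Ls j)) ⬝ᵥ ψ (Ls j) = 1) → ω.IsTorusLimitOf ψ Ls →
      valL U' ≤ ((Finset.univ : Finset (DihedralGroup 4)).card : ℝ)⁻¹ * ∑ g ∈ (Finset.univ : Finset (DihedralGroup 4)),
        (ω.expect (d4ShiftSet g 0 (box 2 7)) (fermionEmbed (PolySite.d4Emb g 0 (box 2 7)) (-oddMomentObsTT p U' 0))).re)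
    (hcL : ∀ U' ∈ Set.Icc UA UL, -valL U' ≤ ((c : ℚ) : ℝ))
    (hO : ∀ s ∈ Set.Icc (p * (2 - UL / Umax)) p,
      ∀ (ω : InfVolFermionState 2) (Ls : ℕ → ℕ) (ψ : ∀ L, Fock (Orb (FermionTorus 2 L))),
      Tendsto Ls atTop atTop →
      (∀ j, IsGroundStateInSector (hubbardTorusTT' (Ls j) 1 s UL) (rectN 1 (Ls j)) 0 (ψ (Ls j))) →
      (∀ j, star (ψ (Ls j)) ⬝ᵥ ψ (Ls j) = 1) → ω.IsTorusLimitOf ψ Ls →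
      valO s ≤ ((Finset.univ : Finset (DihedralGroup 4)).card : ℝ)⁻¹ * ∑ g ∈ (Finset.univ : Finset (DihedralGroup 4)),
        (ω.expect (d4ShiftSet g 0 (box 2 7)) (fermionEmbed (PolySite.d4Emb g 0 (box 2 7)) (-oddMomentObsTT p UL 0))).re)
    (hcO : ∀ s ∈ Set.Icc (p * (2 - UL / Umax)) p, -valO s ≤ ((c : ℚ) : ℝ)) :
    ∀ tp ∈ Set.Icc p q, ∀ U ∈ Set.Icc UA Umax, ObsStiffnessSeqCeilingAt tp U 1 c := by
  intro tp htp U hU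
  have hUP : 0 < U := hUA.trans_le hU.1
  have hUne : U ≠ 0 := hUP.ne'
  -- the source parameter at the bottom station
  by_cases hsA : p ≤ tp * (2 * U - UA) / U
  · -- (BOTTOM) the companion's station leaf on the inner segment `[p, q]`
    have hmem : tp * (2 * U - UA) / U ∈ Set.Icc p q :=
      ⟨hsA, (apexSource_mem_Icc_of_slab (p := p) hUA hU.1 hU.2 hq htp).2⟩
    exact ObsStiffnessSeqCeilingAt_halfFilling_of_forall_apexStation_orbitLower hUA.le valB c hB hcB hU.1 hUP hmem
  · have hsA : tp * (2 * U - UA) / U < p := not_le.mp hsA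
    -- the target is strictly left-leaning: `t′ < 0` and `p < 0`
    have ht0 : tp < 0 := by
      rcases (htp.2.trans hq).eq_or_lt with h0 | h0
      · exfalso
        rw [h0, zero_mul, zero_div] at hsA
        exact absurd (htp.1.trans_eq h0) (not_le.2 hsA)
      · exact h0
    have hp0 : p < 0 := lt_of_le_of_lt htp.1 ht0
    obtain ⟨hU'le, hapexL⟩ := leftEdge_apexSource htp.1 ht0 hUP
    have hU'gt : UA < U * (2 - p / tp) := (apexSource_lt_iff_station_lt_leftEdge ht0 hUP).1 hsA
    -- slot condition for the corner objective `σ = p` against the target `t′`: `2p − 2t′ = k·(source t′)`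
    by_cases hUL : U * (2 - p / tp) ≤ UL
    · -- (LEFT EDGE) source `(p, U')`, own word, slot `p`
      have hmem : U * (2 - p / tp) ∈ Set.Icc UA UL := ⟨hU'gt.le, hUL⟩
      have hk : 0 ≤ 2 * (p - tp) / p := div_nonneg_of_nonpos (by linarith [htp.1]) hp0.le
      have hslot : 2 * p - 2 * tp = 2 * (p - tp) / p * p := by
        rw [div_mul_cancel₀ _ hp0.ne]; ring
      exact ObsStiffnessSeqCeilingAt_halfFilling_of_apexSource_orbitLower_slot p (U * (2 - p / tp)) (valL (U * (2 - p / tp)))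
        (hUA.le.trans hU'gt.le) hU'le hUP hapexL (hL _ hmem) hk hslot c (hcL _ hmem)
    · -- (OVERHANG at `U_L`) source `(s_L, U_L)` with `s_L < p`, corner objective, slot `p`
      have hUL : UL < U * (2 - p / tp) := not_le.mp hUL
      have hLU : UL ≤ U := hUL.le.trans hU'le
      have hL0 : 0 < UL := hUA.trans_le hAL
      have hsL : tp * (2 * U - UL) / U < p := (apexSource_lt_iff_station_lt_leftEdge ht0 hUP).2 hUL
      have hmem : tp * (2 * U - UL) / U ∈ Set.Icc (p * (2 - UL / Umax)) p :=
        ⟨(apexSource_mem_Icc_of_slab (p := p) hL0 hLU hU.2 hq htp).1, hsL.le⟩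
      have hs0 : tp * (2 * U - UL) / U < 0 := hsL.trans hp0
      have hk : 0 ≤ 2 * (p - tp) / (tp * (2 * U - UL) / U) := div_nonneg_of_nonpos (by linarith [htp.1]) hs0.le
      have hslot : 2 * p - 2 * tp = 2 * (p - tp) / (tp * (2 * U - UL) / U) * (tp * (2 * U - UL) / U) := by
        rw [div_mul_cancel₀ _ hs0.ne]; ring
      have hapexO : U * (tp * (2 * U - UL) / U) = (2 * U - UL) * tp := by
        rw [mul_div_assoc', mul_div_cancel_left₀ _ hUne]; ring
      exact ObsStiffnessSeqCeilingAt_halfFilling_of_apexSource_orbitLower_slot p UL (valO (tp * (2 * U - UL) / U)) hL0.le hLU hUP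
        hapexO (hO _ hmem) hk hslot c (hcO _ hmem)

end Curtain

/-! ## §3 EDITIONS: one station with a corner-objective overhang (E1); the «L» bottom + left edge (E2) -/

section Editions

variable {UA Umax p q : ℝ}

/-- **(E1) ONE STATION, CORNER-OBJECTIVE OVERHANG.** Box `[p, q] × [U_A, U_max]`, `q ≤ 0 < U_A ≤ U_max`. An own-word orbit-lower family
`valI` on the INNER source segment `[p, q] × {U_A}` and an orbit-lower family `valO` for the FIXED corner objective `−X₀(p)` on the OVERHANG
`[p(2 − U_A/U_max), p] × {U_A}`, both with `−val ≤ c`, give `ObsStiffnessSeqCeilingAt t′ U 1 c` on the whole box. Compared with the companion's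
`…_on_box_of_forall_apexStation_orbitLower` (own words on the whole segment `[p(2 − U_A/U_max), q]`) the overhang sources are asked for LESS:
`−¼e_{Φ(1,2p,0)}` instead of `−¼e_{Φ(1,2s,0)}`, `|s| > |p|` (smaller by `½(|s| − |p|)·K₂ ≥ 0` on each class, kinematic scale `k(p)` not `k(s)`).
[cite: KomaTasaki1994, §1] [cite: ScalapinoWhiteZhang1993, §II] -/
theorem ObsStiffnessSeqCeilingAt_halfFilling_on_box_of_apexStation_inner_and_cornerObjectiveOverhang (hUA : 0 < UA)
    (hUmax : UA ≤ Umax) (hpq : p ≤ q) (hq : q ≤ 0) (valI valO : ℝ → ℝ) (c : ℚ)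
    (hI : ∀ s ∈ Set.Icc p q,
      ∀ (ω : InfVolFermionState 2) (Ls : ℕ → ℕ) (ψ : ∀ L, Fock (Orb (FermionTorus 2 L))),
      Tendsto Ls atTop atTop →
      (∀ j, IsGroundStateInSector (hubbardTorusTT' (Ls j) 1 s UA) (rectN 1 (Ls j)) 0 (ψ (Ls j))) →
      (∀ j, star (ψ (Ls j)) ⬝ᵥ ψ (Ls j) = 1) → ω.IsTorusLimitOf ψ Ls →
      valI s ≤ ((Finset.univ : Finset (DihedralGroup 4)).card : ℝ)⁻¹ * ∑ g ∈ (Finset.univ : Finset (DihedralGroup 4)),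
        (ω.expect (d4ShiftSet g 0 (box 2 7)) (fermionEmbed (PolySite.d4Emb g 0 (box 2 7)) (-oddMomentObsTT s UA 0))).re)
    (hcI : ∀ s ∈ Set.Icc p q, -valI s ≤ ((c : ℚ) : ℝ))
    (hO : ∀ s ∈ Set.Icc (p * (2 - UA / Umax)) p,
      ∀ (ω : InfVolFermionState 2) (Ls : ℕ → ℕ) (ψ : ∀ L, Fock (Orb (FermionTorus 2 L))),
      Tendsto Ls atTop atTop →
      (∀ j, IsGroundStateInSector (hubbardTorusTT' (Ls j) 1 s UA) (rectN 1 (Ls j)) 0 (ψ (Ls j))) →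
      (∀ j, star (ψ (Ls j)) ⬝ᵥ ψ (Ls j) = 1) → ω.IsTorusLimitOf ψ Ls →
      valO s ≤ ((Finset.univ : Finset (DihedralGroup 4)).card : ℝ)⁻¹ * ∑ g ∈ (Finset.univ : Finset (DihedralGroup 4)),
        (ω.expect (d4ShiftSet g 0 (box 2 7)) (fermionEmbed (PolySite.d4Emb g 0 (box 2 7)) (-oddMomentObsTT p UA 0))).re)
    (hcO : ∀ s ∈ Set.Icc (p * (2 - UA / Umax)) p, -valO s ≤ ((c : ℚ) : ℝ)) :
    ∀ tp ∈ Set.Icc p q, ∀ U ∈ Set.Icc UA Umax, ObsStiffnessSeqCeilingAt tp U 1 c := by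
  -- the curtain with `U_L = U_A`: the left edge degenerates to the corner `(p, U_A)`, an inner source
  refine ObsStiffnessSeqCeilingAt_halfFilling_on_box_of_curtain_orbitLower hUA le_rfl hq valI (fun _ => valI p) valO c hI hcI
    (fun U' hU' => ?_) (fun U' hU' => ?_) hO hcO
  · have hU'A : U' = UA := le_antisymm hU'.2 hU'.1
    subst hU'A
    exact hI p ⟨le_rfl, hpq⟩
  · exact hcI p ⟨le_rfl, hpq⟩

/-- **(E2) THE «L»: BOTTOM INNER SEGMENT + LEFT EDGE, NO OVERHANG.** Box `[p, q] × [U_A, U_max]`, `q ≤ 0 < U_A ≤ U_max`. An own-word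
orbit-lower family `valB` on the bottom inner segment `[p, q] × {U_A}` and an own-word orbit-lower family `valL` on the LEFT EDGE
`{p} × [U_A, U_max]`, both with `−val ≤ c`, give `ObsStiffnessSeqCeilingAt t′ U 1 c` on the whole box: every apex segment that misses the bottom
inner segment crosses the left edge above `U_A`. Every source lies INSIDE the box (kinematic scale ≤ `k(p)`); the price is a `U`-segment family
at `t′ = p` (shared duals along `U`, windows up to `U_max`). [cite: KomaTasaki1994, §1] [cite: ScalapinoWhiteZhang1993, §II] -/
theorem ObsStiffnessSeqCeilingAt_halfFilling_on_box_of_bottomEdge_and_leftEdge (hUA : 0 < UA) (hUmax : UA ≤ Umax) (hq : q ≤ 0)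
    (valB valL : ℝ → ℝ) (c : ℚ)
    (hB : ∀ s ∈ Set.Icc p q,
      ∀ (ω : InfVolFermionState 2) (Ls : ℕ → ℕ) (ψ : ∀ L, Fock (Orb (FermionTorus 2 L))),
      Tendsto Ls atTop atTop →
      (∀ j, IsGroundStateInSector (hubbardTorusTT' (Ls j) 1 s UA) (rectN 1 (Ls j)) 0 (ψ (Ls j))) →
      (∀ j, star (ψ (Ls j)) ⬝ᵥ ψ (Ls j) = 1) → ω.IsTorusLimitOf ψ Ls →
      valB s ≤ ((Finset.univ : Finset (DihedralGroup 4)).card : ℝ)⁻¹ * ∑ g ∈ (Finset.univ : Finset (DihedralGroup 4)),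
        (ω.expect (d4ShiftSet g 0 (box 2 7)) (fermionEmbed (PolySite.d4Emb g 0 (box 2 7)) (-oddMomentObsTT s UA 0))).re)
    (hcB : ∀ s ∈ Set.Icc p q, -valB s ≤ ((c : ℚ) : ℝ))
    (hL : ∀ U' ∈ Set.Icc UA Umax,
      ∀ (ω : InfVolFermionState 2) (Ls : ℕ → ℕ) (ψ : ∀ L, Fock (Orb (FermionTorus 2 L))),
      Tendsto Ls atTop atTop →
      (∀ j, IsGroundStateInSector (hubbardTorusTT' (Ls j) 1 p U') (rectN 1 (Ls j)) 0 (ψ (Ls j))) →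
      (∀ j, star (ψ (Ls j)) ⬝ᵥ ψ (Ls j) = 1) → ω.IsTorusLimitOf ψ Ls →
      valL U' ≤ ((Finset.univ : Finset (DihedralGroup 4)).card : ℝ)⁻¹ * ∑ g ∈ (Finset.univ : Finset (DihedralGroup 4)),
        (ω.expect (d4ShiftSet g 0 (box 2 7)) (fermionEmbed (PolySite.d4Emb g 0 (box 2 7)) (-oddMomentObsTT p U' 0))).re)
    (hcL : ∀ U' ∈ Set.Icc UA Umax, -valL U' ≤ ((c : ℚ) : ℝ)) :
    ∀ tp ∈ Set.Icc p q, ∀ U ∈ Set.Icc UA Umax, ObsStiffnessSeqCeilingAt tp U 1 c := by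
  -- the curtain with `U_L = U_max`: the overhang degenerates to the corner `(p, U_max)`, a left-edge source
  have hmax : 0 < Umax := hUA.trans_le hUmax
  refine ObsStiffnessSeqCeilingAt_halfFilling_on_box_of_curtain_orbitLower hUA hUmax hq valB valL (fun _ => valL Umax) c hB
    hcB hL hcL (fun s hs => ?_) (fun s hs => ?_)
  · have h2 : p * (2 - Umax / Umax) = p := by rw [div_self hmax.ne']; ring
    rw [h2] at hs
    have hsp : s = p := le_antisymm hs.2 hs.1
    subst hsp
    exact hL Umax ⟨hUmax, le_rfl⟩
  · exact hcL Umax ⟨hUmax, le_rfl⟩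

end Editions

end Summit.Ventures.CertifiedManyBodySolver.Observables

end
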